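import Literature.NumberTheory.Automorphic.HidaControlDominantPointProofs
import Literature.NumberTheory.Automorphic.HeckePolynomialPoint
import Literature.NumberTheory.Automorphic.HidaLevelDiamondAction
import Literature.NumberTheory.Automorphic.GlobalScalarApproximation
import HarnessLib

/-!
# The weight-twisted symbol ring of a dominant arithmetic point

Topic `NumberTheory/Automorphic`; namespace `Literature.NumberTheory.Automorphic.BigHeckeGLn.TameLevel`;
definitions with bodies and theorems (no named fact, no `sorry`).

For the levelwise support argument proving `hidaControl_dominantOrdinaryPoint` one needs a
polynomial ring of Hecke symbols on which the "independence of weight" twist of the diamond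
operators is INTEGRAL.  Local diamonds `⟨u⟩_v` are twisted by `∏_τ τ(u)^{k-2} ∉ ℤ`, but the GLOBAL
diamonds `∏_{v ∣ p} ⟨(1, u)⟩_v` of a global `u ≡ 1 (mod p^{c₀})` are twisted by `N_{K/ℚ}(u)^{k-2} ∈ ℤ`.
So we let `ℤ[WtSym]` be the polynomial ring on the symbols `T_{w,j}`, `T_{w,2}⁻¹` (Hida places `w`,
including `U_{v,j}` at `v ∣ p`) and two symbols `D⁰_d, D¹_d` for every global unit datum
`d = (u, (û_v)_v)` of depth `c₀` (`GlobalUnitDatum`), mapped into `ℤ[T^abs] = MvPolynomial hidaElements ℤ`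
by `symbolMap : Dⁱ_d ↦ ∏_v X_{⟨e_i(û_v)⟩_v}`; the **weight twist**
`weightTwist k : D¹_d ↦ N(u)^{k-2} D¹_d`, identity on the other symbols; the augmentation ideal
`augIdeal = (Dⁱ_d - 1)` and the **weight ideal** `weightIdeal k = (N(u)^{k-2} D¹_d - 1, D⁰_d - 1)`,
its twist (`map_weightTwist_augIdeal`).  Main point (`apply_symbolMap_eq_zero_of_mem_weightIdeal`,
`exists_depth_forall_apply_symbolMap_eq_zero`): **a continuous point `x` with dominant diamond weight
`k ≥ 2` kills `symbolMap (weightIdeal k)`** for a suitable depth `c₀`, by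
`HasDominantDiamondWeight.exists_forall_eq`.

[cite: Hida1994AIF, §1 p. 1293, §3 Thm 3.2] [cite: KhareThorne2017, §6.4, Cor. 6.15; §6.5]

## References

* H. Hida, Ann. Inst. Fourier 44 (1994). [Hida1994AIF]
* C. Khare, J. A. Thorne, Amer. J. Math. 139 (2017), §6. [KhareThorne2017]
-/

noncomputable section

open IsDedekindDomain MvPolynomial
open scoped NumberField

namespace Literature.NumberTheory.Automorphic

namespace BigHeckeGLn

/-- **A global unit datum of depth `c₀`**: `u ∈ 𝓞 K` with `u ≡ 1 (mod p^{c₀})`, together with units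
`û_v ∈ 𝒪_v^×` (`v ∣ p`) equal to `u` in `K_v`. [cite: KhareThorne2017, §6.4] -/
structure GlobalUnitDatum (K : Type) [Field K] [NumberField K] (p : ℕ) (c₀ : ℕ) where
  /-- the global element -/
  u : 𝓞 K
  /-- its local units above `p` -/
  û : ∀ v : HeightOneSpectrum (𝓞 K), (p : 𝓞 K) ∈ v.asIdeal → (v.adicCompletionIntegers K)ˣ
  /-- compatibility `û_v = u` in `K_v` -/
  compat : ∀ (v : HeightOneSpectrum (𝓞 K)) (hv : (p : 𝓞 K) ∈ v.asIdeal),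
    ((û v hv : v.adicCompletionIntegers K) : v.adicCompletion K) = algebraMap K (v.adicCompletion K) (u : K)
  /-- the congruence `u ≡ 1 (mod p^{c₀})` -/
  cong : (p : 𝓞 K) ^ c₀ ∣ u - 1

namespace GlobalUnitDatum

variable {K : Type} [Field K] [NumberField K] {p : ℕ} [Fact p.Prime] {c₀ : ℕ}

/-- `u ≠ 0` (it is a unit at a place above `p`). [folklore] -/
theorem u_ne_zero (d : GlobalUnitDatum K p c₀) : d.u ≠ 0 := by
  obtain ⟨v, hv⟩ : ∃ v : HeightOneSpectrum (𝓞 K), (p : 𝓞 K) ∈ v.asIdeal := exists_mem_asIdeal_natCast p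
  intro h
  have h1 := d.compat v hv
  have h0 : ((d.û v hv : v.adicCompletionIntegers K) : v.adicCompletion K) ≠ 0 := by
    rw [Ne, ZeroMemClass.coe_eq_zero]
    exact (d.û v hv).ne_zero
  rw [h1, h] at h0
  exact h0 (by simp)

/-- `N(u) ≠ 0`. [folklore] -/
theorem norm_ne_zero (d : GlobalUnitDatum K p c₀) : Algebra.norm ℤ d.u ≠ 0 :=
  Algebra.norm_ne_zero_iff.2 d.u_ne_zero

end GlobalUnitDatum

namespace TameLevel

variable {K : Type} [Field K] [NumberField K] {p : ℕ} [Fact p.Prime] (𝒰 : TameLevel 2 K p)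

/-! ### Symbols -/

/-- The Hida elements `t_{w,j}`, `t_{w,2}⁻¹` (no diamonds). [cite: KhareThorne2017, §2.4] -/
def tuElements : Set (FiniteAdelicGL 2 K) :=
  {g | ∃ w, 𝒰.IsHidaPlace w ∧ ∃ j : ℕ, g = heckeElement 2 K w j} ∪
    {g | ∃ w, 𝒰.IsHidaPlace w ∧ g = (heckeElement 2 K w 2)⁻¹}

/-- `tuElements ⊆ hidaElements`. [folklore] -/
theorem tuElements_subset_hidaElements : 𝒰.tuElements ⊆ 𝒰.hidaElements :=
  Set.subset_union_left

/-- **The weight symbols**: `t_{w,j}`, `t_{w,2}⁻¹`, and `Dⁱ_d` (`i = 0, 1`) for the global unit data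
`d` of depth `c₀`. [cite: KhareThorne2017, §6.5] -/
abbrev WtSym (c₀ : ℕ) : Type :=
  𝒰.tuElements ⊕ (Fin 2 × GlobalUnitDatum K p c₀)

/-- `Dⁱ_d ↦ ∏_{v ∣ p} X_{⟨e_i(û_v)⟩_v}` in `ℤ[T^abs]`. [cite: KhareThorne2017, §6.4] -/
def diamondMonomial {c₀ : ℕ} (i : Fin 2) (d : GlobalUnitDatum K p c₀) : MvPolynomial 𝒰.hidaElements ℤ :=
  ∏ v : PlacesAbove K p,
    X ⟨diamondElement 2 K v.1 (Pi.mulSingle i (d.û v.1 v.2)), 𝒰.diamondElement_mem_hidaElements v.2 _⟩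

/-- **`symbolMap : ℤ[WtSym] → ℤ[T^abs]`**. [folklore] -/
def symbolMap (c₀ : ℕ) : MvPolynomial (𝒰.WtSym c₀) ℤ →+* MvPolynomial 𝒰.hidaElements ℤ :=
  (bind₁ (Sum.elim (fun g : 𝒰.tuElements => X ⟨g.1, 𝒰.tuElements_subset_hidaElements g.2⟩)
    (fun q : Fin 2 × GlobalUnitDatum K p c₀ => 𝒰.diamondMonomial q.1 q.2))).toRingHom

/-- `symbolMap` on a Hecke symbol. [folklore] -/
@[simp]
theorem symbolMap_X_inl {c₀ : ℕ} (g : 𝒰.tuElements) :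
    𝒰.symbolMap c₀ (X (Sum.inl g)) = X ⟨g.1, 𝒰.tuElements_subset_hidaElements g.2⟩ := by
  simp [symbolMap]

/-- `symbolMap` on a diamond symbol. [folklore] -/
@[simp]
theorem symbolMap_X_inr {c₀ : ℕ} (q : Fin 2 × GlobalUnitDatum K p c₀) :
    𝒰.symbolMap c₀ (X (Sum.inr q)) = 𝒰.diamondMonomial q.1 q.2 := by
  simp [symbolMap]

/-- **The weight twist `D¹_d ↦ N(u)^{k-2} D¹_d`** (identity on the other symbols). [cite: KhareThorne2017, §6.4] -/
def weightTwist (k c₀ : ℕ) : MvPolynomial (𝒰.WtSym c₀) ℤ →+* MvPolynomial (𝒰.WtSym c₀) ℤ :=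
  (bind₁ (Sum.elim (fun g : 𝒰.tuElements => (X (Sum.inl g) : MvPolynomial (𝒰.WtSym c₀) ℤ))
    (fun q : Fin 2 × GlobalUnitDatum K p c₀ =>
      if q.1 = 1 then C ((Algebra.norm ℤ q.2.u) ^ (k - 2)) * X (Sum.inr q) else X (Sum.inr q)))).toRingHom

/-- `weightTwist` on a Hecke symbol. [folklore] -/
@[simp]
theorem weightTwist_X_inl {k c₀ : ℕ} (g : 𝒰.tuElements) :
    𝒰.weightTwist k c₀ (X (Sum.inl g)) = X (Sum.inl g) := by
  simp [weightTwist]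

/-- `weightTwist (D¹_d) = N(u)^{k-2} D¹_d`. [folklore] -/
@[simp]
theorem weightTwist_X_inr_one {k c₀ : ℕ} (d : GlobalUnitDatum K p c₀) :
    𝒰.weightTwist k c₀ (X (Sum.inr (1, d))) = C ((Algebra.norm ℤ d.u) ^ (k - 2)) * X (Sum.inr (1, d)) := by
  simp [weightTwist]

/-- `weightTwist (D⁰_d) = D⁰_d`. [folklore] -/
@[simp]
theorem weightTwist_X_inr_zero {k c₀ : ℕ} (d : GlobalUnitDatum K p c₀) :
    𝒰.weightTwist k c₀ (X (Sum.inr (0, d))) = X (Sum.inr (0, d)) := by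
  simp [weightTwist]

/-- **The augmentation ideal `(Dⁱ_d - 1)`.** [folklore] -/
def augIdeal (c₀ : ℕ) : Ideal (MvPolynomial (𝒰.WtSym c₀) ℤ) :=
  Ideal.span (Set.range fun q : Fin 2 × GlobalUnitDatum K p c₀ => (X (Sum.inr q) : MvPolynomial (𝒰.WtSym c₀) ℤ) - 1)

/-- **The weight ideal `(N(u)^{k-2} D¹_d - 1, D⁰_d - 1)`.** [cite: KhareThorne2017, §6.4] -/
def weightIdeal (k c₀ : ℕ) : Ideal (MvPolynomial (𝒰.WtSym c₀) ℤ) :=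
  Ideal.span (Set.range fun q : Fin 2 × GlobalUnitDatum K p c₀ => 𝒰.weightTwist k c₀ (X (Sum.inr q)) - 1)

/-- **The weight ideal is the twist of the augmentation ideal.** [folklore] -/
theorem map_weightTwist_augIdeal (k c₀ : ℕ) :
    (𝒰.augIdeal c₀).map (𝒰.weightTwist k c₀) = 𝒰.weightIdeal k c₀ := by
  rw [augIdeal, weightIdeal, Ideal.map_span, ← Set.range_comp]
  refine congrArg Ideal.span (congrArg Set.range (funext fun q => ?_))
  rw [Function.comp_apply, map_sub, map_one]

/-! ### The point kills the weight ideal -/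

variable [Fact 𝒰.IsMaximalAbove]

/-- `heckePolyHom (∏_v X_{⟨e_i(û_v)⟩_v}) = ∏_v ⟨e_i(û_v)⟩_v` in `𝕋`. [folklore] -/
theorem heckePolyHom_diamondMonomial {c₀ : ℕ} (i : Fin 2) (d : GlobalUnitDatum K p c₀) :
    𝒰.heckePolyHom (𝒰.diamondMonomial i d) = ∏ v : PlacesAbove K p, 𝒰.ordDiamond v.2 (Pi.mulSingle i (d.û v.1 v.2)) := by
  rw [diamondMonomial, map_prod]
  exact Finset.prod_congr rfl fun v _ => by rw [heckePolyHom_X]; rfl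

/-- **A point with the weight-`k` diamond values kills `symbolMap (weightIdeal k)`**:
if `x(∏_v ⟨(1,û_v)⟩_v) = N(u)^{2-k}` and `x(∏_v ⟨(û_v,1)⟩_v) = 1` for all global unit data of depth
`c₀`, then `x (heckePolyHom (symbolMap r)) = 0` for `r ∈ weightIdeal k c₀` (`k ≥ 2`).
[cite: Hida1994AIF, §3] [cite: KhareThorne2017, §6.5] -/
theorem apply_symbolMap_eq_zero_of_mem_weightIdeal {A : Type*} [Field A] [CharZero A]
    (x : OrdinaryHeckeAlgebraGLn 𝒰 →+* A) {k : ℕ} (hk : 2 ≤ k) {c₀ : ℕ}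
    (h₁ : ∀ d : GlobalUnitDatum K p c₀,
      (∏ v : PlacesAbove K p, x (𝒰.ordDiamond v.2 (Pi.mulSingle (1 : Fin 2) (d.û v.1 v.2)))) =
        ((Algebra.norm ℤ d.u : ℤ) : A) ^ (2 - (k : ℤ)))
    (h₀ : ∀ d : GlobalUnitDatum K p c₀,
      (∏ v : PlacesAbove K p, x (𝒰.ordDiamond v.2 (Pi.mulSingle (0 : Fin 2) (d.û v.1 v.2)))) = 1)
    {r : MvPolynomial (𝒰.WtSym c₀) ℤ} (hr : r ∈ 𝒰.weightIdeal k c₀) :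
    x (𝒰.heckePolyHom (𝒰.symbolMap c₀ r)) = 0 := by
  rw [← RingHom.comp_apply, ← RingHom.comp_apply, ← RingHom.mem_ker]
  refine (Ideal.span_le.2 ?_) hr
  rintro _ ⟨⟨i, d⟩, rfl⟩
  rw [SetLike.mem_coe, RingHom.mem_ker, map_sub, map_one, sub_eq_zero, RingHom.comp_apply, RingHom.comp_apply]
  revert i
  refine Fin.forall_fin_two.2 ⟨?_, ?_⟩
  · -- `D⁰_d ↦ ∏_v ⟨(û_v, 1)⟩_v ↦ 1`
    rw [weightTwist_X_inr_zero, symbolMap_X_inr, heckePolyHom_diamondMonomial, map_prod]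
    exact h₀ d
  · -- `N(u)^{k-2} D¹_d ↦ N(u)^{k-2} ∏_v ⟨(1, û_v)⟩_v ↦ N(u)^{k-2} N(u)^{2-k} = 1`
    rw [weightTwist_X_inr_one, map_mul, map_mul, map_mul, symbolMap_X_inr, heckePolyHom_diamondMonomial,
      map_prod, h₁ d]
    have hC : x (𝒰.heckePolyHom (𝒰.symbolMap c₀ (C ((Algebra.norm ℤ d.u) ^ (k - 2))))) =
        ((Algebra.norm ℤ d.u : ℤ) : A) ^ (k - 2) := by
      rw [symbolMap, AlgHom.toRingHom_eq_coe, RingHom.coe_coe, bind₁_C_right, heckePolyHom,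
        coe_eval₂Hom, eval₂_C, map_pow, eq_intCast, map_pow, map_intCast]
    rw [hC]
    have hN : ((Algebra.norm ℤ d.u : ℤ) : A) ≠ 0 := Int.cast_ne_zero.2 d.norm_ne_zero
    rw [← zpow_natCast, ← zpow_add₀ hN, Nat.cast_sub hk]
    norm_num

/-- **Depth at which a dominant point kills the weight ideal**: for a CONTINUOUS `x` with dominant
diamond weight `k ≥ 2` there is `c₀` with `x (heckePolyHom (symbolMap c₀ r)) = 0` for all
`r ∈ weightIdeal k c₀`. [cite: Hida1994AIF, §1 p. 1293, §3] [cite: KhareThorne2017, §6.4, Cor. 6.15] -/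
theorem exists_depth_forall_apply_symbolMap_eq_zero (x : OrdinaryHeckeAlgebraGLn 𝒰 →+* PadicAlgCl p)
    (hx : Continuous x) {k : ℕ} (hk : 2 ≤ k) (h : 𝒰.HasDominantDiamondWeight x k) :
    ∃ c₀ : ℕ, ∀ r ∈ 𝒰.weightIdeal k c₀, x (𝒰.heckePolyHom (𝒰.symbolMap c₀ r)) = 0 := by
  have h𝒰 : 𝒰.IsMaximalAbove := Fact.out
  obtain ⟨c₀, hc₀⟩ := HasDominantDiamondWeight.exists_forall_eq h𝒰 hx h
  refine ⟨c₀, fun r hr => 𝒰.apply_symbolMap_eq_zero_of_mem_weightIdeal x hk (fun d => ?_) (fun d => ?_) hr⟩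
  · have h1 := (hc₀ d.u d.û d.compat d.cong).1
    rwa [finprod_eq_prod_of_fintype] at h1
  · have h0 := (hc₀ d.u d.û d.compat d.cong).2
    rwa [finprod_eq_prod_of_fintype] at h0

/-! ### The symbols without inverses

For the comparison with weight-`k` coefficients one must drop the symbols `t_{w,2}⁻¹` (at `v ∣ p`
the central element `t_{v,2} = diag(ϖ_v, ϖ_v)` is not invertible on `Sym^{k-2}(𝒪/p^c)`): the smaller
symbol ring `ℤ[WtSym₀]` on the `t_{w,j}` and the global diamond symbols, with the same twist and
weight ideal, mapped into `ℤ[WtSym]` by `inclSym`. -/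

/-- The Hida elements `t_{w,j}` (no inverses, no diamonds). [cite: KhareThorne2017, §2.4] -/
def tElements : Set (FiniteAdelicGL 2 K) :=
  {g | ∃ w, 𝒰.IsHidaPlace w ∧ ∃ j : ℕ, g = heckeElement 2 K w j}

omit [Fact 𝒰.IsMaximalAbove] in
/-- `tElements ⊆ tuElements`. [folklore] -/
theorem tElements_subset_tuElements : 𝒰.tElements ⊆ 𝒰.tuElements :=
  Set.subset_union_left

omit [Fact 𝒰.IsMaximalAbove] in
/-- `tElements ⊆ hidaElements`. [folklore] -/
theorem tElements_subset_hidaElements : 𝒰.tElements ⊆ 𝒰.hidaElements :=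
  𝒰.tElements_subset_tuElements.trans 𝒰.tuElements_subset_hidaElements

omit [Fact 𝒰.IsMaximalAbove] in
/-- `t_{w,j} ∈ tElements` for a Hida place `w`. [folklore] -/
theorem heckeElement_mem_tElements {w : HeightOneSpectrum (𝓞 K)} (hw : 𝒰.IsHidaPlace w) (j : ℕ) :
    heckeElement 2 K w j ∈ 𝒰.tElements :=
  ⟨w, hw, j, rfl⟩

/-- **The weight symbols without inverses**: `t_{w,j}` and `Dⁱ_d`. [cite: KhareThorne2017, §6.5] -/
abbrev WtSym₀ (c₀ : ℕ) : Type :=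
  𝒰.tElements ⊕ (Fin 2 × GlobalUnitDatum K p c₀)

/-- `ℤ[WtSym₀] → ℤ[WtSym]`. [folklore] -/
def inclSym (c₀ : ℕ) : MvPolynomial (𝒰.WtSym₀ c₀) ℤ →+* MvPolynomial (𝒰.WtSym c₀) ℤ :=
  (rename (Sum.map (fun g : 𝒰.tElements => (⟨g.1, 𝒰.tElements_subset_tuElements g.2⟩ : 𝒰.tuElements)) id)).toRingHom

omit [Fact 𝒰.IsMaximalAbove] in
/-- `inclSym` on a Hecke symbol. [folklore] -/
@[simp]
theorem inclSym_X_inl {c₀ : ℕ} (g : 𝒰.tElements) :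
    𝒰.inclSym c₀ (X (Sum.inl g)) = X (Sum.inl ⟨g.1, 𝒰.tElements_subset_tuElements g.2⟩) := by
  simp [inclSym]

omit [Fact 𝒰.IsMaximalAbove] in
/-- `inclSym` on a diamond symbol. [folklore] -/
@[simp]
theorem inclSym_X_inr {c₀ : ℕ} (q : Fin 2 × GlobalUnitDatum K p c₀) :
    𝒰.inclSym c₀ (X (Sum.inr q)) = X (Sum.inr q) := by
  simp [inclSym]

/-- **`symbolMap₀ : ℤ[WtSym₀] → ℤ[T^abs]`** (`= symbolMap ∘ inclSym`). [folklore] -/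
def symbolMap₀ (c₀ : ℕ) : MvPolynomial (𝒰.WtSym₀ c₀) ℤ →+* MvPolynomial 𝒰.hidaElements ℤ :=
  (𝒰.symbolMap c₀).comp (𝒰.inclSym c₀)

omit [Fact 𝒰.IsMaximalAbove] in
/-- `symbolMap₀` on a Hecke symbol. [folklore] -/
@[simp]
theorem symbolMap₀_X_inl {c₀ : ℕ} (g : 𝒰.tElements) :
    𝒰.symbolMap₀ c₀ (X (Sum.inl g)) = X ⟨g.1, 𝒰.tElements_subset_hidaElements g.2⟩ := by
  rw [symbolMap₀, RingHom.comp_apply, inclSym_X_inl, symbolMap_X_inl]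

omit [Fact 𝒰.IsMaximalAbove] in
/-- `symbolMap₀` on a diamond symbol. [folklore] -/
@[simp]
theorem symbolMap₀_X_inr {c₀ : ℕ} (q : Fin 2 × GlobalUnitDatum K p c₀) :
    𝒰.symbolMap₀ c₀ (X (Sum.inr q)) = 𝒰.diamondMonomial q.1 q.2 := by
  rw [symbolMap₀, RingHom.comp_apply, inclSym_X_inr, symbolMap_X_inr]

/-- **The weight twist on `ℤ[WtSym₀]`.** [cite: KhareThorne2017, §6.4] -/
def weightTwist₀ (k c₀ : ℕ) : MvPolynomial (𝒰.WtSym₀ c₀) ℤ →+* MvPolynomial (𝒰.WtSym₀ c₀) ℤ :=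
  (bind₁ (Sum.elim (fun g : 𝒰.tElements => (X (Sum.inl g) : MvPolynomial (𝒰.WtSym₀ c₀) ℤ))
    (fun q : Fin 2 × GlobalUnitDatum K p c₀ =>
      if q.1 = 1 then C ((Algebra.norm ℤ q.2.u) ^ (k - 2)) * X (Sum.inr q) else X (Sum.inr q)))).toRingHom

omit [Fact 𝒰.IsMaximalAbove] in
/-- `weightTwist₀` on a Hecke symbol. [folklore] -/
@[simp]
theorem weightTwist₀_X_inl {k c₀ : ℕ} (g : 𝒰.tElements) :
    𝒰.weightTwist₀ k c₀ (X (Sum.inl g)) = X (Sum.inl g) := by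
  simp [weightTwist₀]

omit [Fact 𝒰.IsMaximalAbove] in
/-- `weightTwist₀ (D¹_d) = N(u)^{k-2} D¹_d`. [folklore] -/
@[simp]
theorem weightTwist₀_X_inr_one {k c₀ : ℕ} (d : GlobalUnitDatum K p c₀) :
    𝒰.weightTwist₀ k c₀ (X (Sum.inr (1, d))) = C ((Algebra.norm ℤ d.u) ^ (k - 2)) * X (Sum.inr (1, d)) := by
  simp [weightTwist₀]

omit [Fact 𝒰.IsMaximalAbove] in
/-- `weightTwist₀ (D⁰_d) = D⁰_d`. [folklore] -/
@[simp]
theorem weightTwist₀_X_inr_zero {k c₀ : ℕ} (d : GlobalUnitDatum K p c₀) :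
    𝒰.weightTwist₀ k c₀ (X (Sum.inr (0, d))) = X (Sum.inr (0, d)) := by
  simp [weightTwist₀]

omit [Fact 𝒰.IsMaximalAbove] in
/-- `inclSym` intertwines the two twists. [folklore] -/
theorem inclSym_comp_weightTwist₀ (k c₀ : ℕ) :
    (𝒰.inclSym c₀).comp (𝒰.weightTwist₀ k c₀) = (𝒰.weightTwist k c₀).comp (𝒰.inclSym c₀) := by
  refine RingHom.ext fun r => ?_
  induction r using MvPolynomial.induction_on with
  | C a => simp [inclSym, weightTwist₀, weightTwist]
  | add f g hf hg => rw [map_add, map_add, hf, hg]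
  | mul_X f q hf =>
    rw [map_mul, map_mul, hf]
    congr 1
    rcases q with g | ⟨i, d⟩
    · rw [RingHom.comp_apply, RingHom.comp_apply, weightTwist₀_X_inl, inclSym_X_inl, weightTwist_X_inl]
    · rw [RingHom.comp_apply, RingHom.comp_apply, inclSym_X_inr]
      revert i
      refine Fin.forall_fin_two.2 ⟨?_, ?_⟩
      · rw [weightTwist₀_X_inr_zero, weightTwist_X_inr_zero, inclSym_X_inr]
      · rw [weightTwist₀_X_inr_one, weightTwist_X_inr_one, map_mul, inclSym_X_inr]
        simp [inclSym]

/-- **The augmentation ideal of `ℤ[WtSym₀]`.** [folklore] -/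
def augIdeal₀ (c₀ : ℕ) : Ideal (MvPolynomial (𝒰.WtSym₀ c₀) ℤ) :=
  Ideal.span (Set.range fun q : Fin 2 × GlobalUnitDatum K p c₀ => (X (Sum.inr q) : MvPolynomial (𝒰.WtSym₀ c₀) ℤ) - 1)

/-- **The weight ideal of `ℤ[WtSym₀]`.** [cite: KhareThorne2017, §6.4] -/
def weightIdeal₀ (k c₀ : ℕ) : Ideal (MvPolynomial (𝒰.WtSym₀ c₀) ℤ) :=
  Ideal.span (Set.range fun q : Fin 2 × GlobalUnitDatum K p c₀ => 𝒰.weightTwist₀ k c₀ (X (Sum.inr q)) - 1)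

omit [Fact 𝒰.IsMaximalAbove] in
/-- The weight ideal is the twist of the augmentation ideal. [folklore] -/
theorem map_weightTwist₀_augIdeal₀ (k c₀ : ℕ) :
    (𝒰.augIdeal₀ c₀).map (𝒰.weightTwist₀ k c₀) = 𝒰.weightIdeal₀ k c₀ := by
  rw [augIdeal₀, weightIdeal₀, Ideal.map_span, ← Set.range_comp]
  refine congrArg Ideal.span (congrArg Set.range (funext fun q => ?_))
  rw [Function.comp_apply, map_sub, map_one]

omit [Fact 𝒰.IsMaximalAbove] in
/-- `inclSym (weightIdeal₀) ≤ weightIdeal`. [folklore] -/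
theorem map_inclSym_weightIdeal₀_le (k c₀ : ℕ) :
    (𝒰.weightIdeal₀ k c₀).map (𝒰.inclSym c₀) ≤ 𝒰.weightIdeal k c₀ := by
  rw [weightIdeal₀, Ideal.map_span]
  refine Ideal.span_le.2 ?_
  rintro _ ⟨_, ⟨q, rfl⟩, rfl⟩
  rw [map_sub, map_one, ← RingHom.comp_apply, inclSym_comp_weightTwist₀, RingHom.comp_apply, inclSym_X_inr]
  exact Ideal.subset_span ⟨q, rfl⟩

/-- **A continuous point with dominant diamond weight `k ≥ 2` kills `symbolMap₀ (weightIdeal₀ k)`**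
at a suitable depth `c₀`. [cite: Hida1994AIF, §3] [cite: KhareThorne2017, §6.4, Cor. 6.15] -/
theorem exists_depth_forall_apply_symbolMap₀_eq_zero (x : OrdinaryHeckeAlgebraGLn 𝒰 →+* PadicAlgCl p)
    (hx : Continuous x) {k : ℕ} (hk : 2 ≤ k) (h : 𝒰.HasDominantDiamondWeight x k) :
    ∃ c₀ : ℕ, ∀ r ∈ 𝒰.weightIdeal₀ k c₀, x (𝒰.heckePolyHom (𝒰.symbolMap₀ c₀ r)) = 0 := by
  obtain ⟨c₀, hc₀⟩ := 𝒰.exists_depth_forall_apply_symbolMap_eq_zero x hx hk h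
  exact ⟨c₀, fun r hr => hc₀ _ (𝒰.map_inclSym_weightIdeal₀_le k c₀ (Ideal.mem_map_of_mem _ hr))⟩

end TameLevel

end BigHeckeGLn

end Literature.NumberTheory.Automorphic
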